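import Summits.HodgeConjecture.CorCM.GaloisCyclicSemidirectEightNondegenerate
import Summits.HodgeConjecture.CorCM.CyclotomicFourPNormObstruction
import HarnessLib

/-!
# `Gal(K/ℚ) ≅ C_p ⋊ C₈` with `p ≡ 5 (mod 8)` is GOOD: the Hodge conjecture for all powers of every simple CM abelian
# `4p`-fold with complex multiplication by `K` — unconditionally (`p = 5, 13, 29, 37, 53, 61, …`)

COR-CM (cell `pub-hodgecm2`), binder seat b04 (gen 25), count-neutral claim CYCLIC-SEMIDIRECT-EIGHT, part IV (capstone): part II
(`CorCM/GaloisCyclicSemidirectEightNondegenerate`) proved nondegeneracy of every primitive CM type of a Galois CM field with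
group `C_p ⋊ C₈` (the generator of `C₈` inverting `C_p`) modulo the norm hypothesis «`±i` is not a quotient of norms `z ρ(z)`
for `ρ : ℚ(ζ_{4p}) → ℂ`, `ζ_{4p} ↦ ζ_{4p}^{2p−1}`»; part III (`CorCM/CyclotomicFourPNormObstruction`) proved that hypothesis for
every prime `p ≡ 5 (mod 8)` by an elementary `(1 + ζ_{4p}²)`-adic descent in `ℤ[ζ_{4p}]`.  KERNEL ONLY: theorems; no
definition, no named fact, no `sorry`.  `HC_CM` is neither used nor claimed.

THEOREM (`isNondegenerate_of_isPrimitive_of_mod_eight_eq_five`, `hodgeConjectureFor_pow_of_isSimple_of_mod_eight_eq_five`).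
Let `K` be a Galois CM field with `Gal(K/ℚ) ≅ C_p ⋊ C₈ = ⟨u, y | u^p = y⁸ = 1, y u y⁻¹ = u⁻¹⟩`, `p ≡ 5 (mod 8)` prime.  Then
every primitive CM type of `K` is nondegenerate (rank `4p + 1`); every SIMPLE abelian variety `A` (of dimension `4p`) with
complex multiplication by `K` satisfies `Bᵐ(Aⁿ) ⊗ ℂ = Dᵐ(Aⁿ) ⊗ ℂ` and the HODGE CONJECTURE together with ALL ITS POWERS.  In the
classification of this lineage: `C_p ⋊ C₈` is GOOD for `p ≡ 5 (mod 8)` and BAD for `p = 3` (gen 20, order-24 table) and `p = 7`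
(seat census, this gen: ≈ 9·10⁴ primitive degenerate two-sheet types); conjecturally GOOD ⟺ `p ≡ 5 (mod 8)` (for
`p ≡ 1 (mod 8)` or `p ≡ 3 (mod 4)`, `±i` IS a local norm at `p`).  Together with QUATERNION-CYCLIC-PRIME (`Q₈ × C_p`, GOOD iff
`ord_p(2)` odd conjecturally, GOOD proved for `ord_p(2)` odd) these are the two families of gen 20's list (iii) — groups with a
unique involution and a cyclic Sylow `2`-subgroup, no skew CM sets — whose status is decided by an ARITHMETIC invariant of `p`.

* §1 **`isNondegenerate_of_isPrimitive_of_mod_eight_eq_five`**, `cmTypeRank_eq_of_isPrimitive_of_mod_eight_eq_five`.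
* §2 **`hodgeConjectureFor_pow_of_isSimple_of_mod_eight_eq_five`**, `hodgeConjectureFor_of_isSimple_of_mod_eight_eq_five`,
  `hodgeClassSpan_pow_eq_divisorClassesSpan_of_isSimple_of_mod_eight_eq_five`.
* §3 Instances `p = 5` (order `40`, CM `20`-folds), `p = 13` (order `104`, CM `52`-folds).

## References

* [Kubota1965] T. Kubota, Trans. AMS 118 (1965), §2, §4 Lemma 2.
* [Dodson1984] B. Dodson, *The structure of Galois groups of CM-fields*, Trans. AMS 283 (1984), §3.1, §5.3.
* [Shimura1998] G. Shimura, *Abelian Varieties with Complex Multiplication and Modular Functions*, §8.2 Prop. 26.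
* [Gordon1999HodgeAVSurvey] B. B. Gordon, *A survey of the Hodge conjecture for abelian varieties*, Thm. 6.4, §9.4.
* [FeinGordonSmith1971] B. Fein, B. Gordon, J. H. Smith, J. Number Theory 3 (1971), 310–315.
-/

noncomputable section

open CategoryTheory CategoryTheory.Limits NumberField
open scoped BigOperators

namespace Summit.HodgeConjecture.CorCM.GaloisCyclicSemidirectEight

open Literature.NumberTheory.ComplexMultiplication
open Literature.AlgebraicGeometry.Motives (AbelianVariety CMType)
open Literature.AlgebraicGeometry.HodgeTheory
open Literature.AlgebraicGeometry.ComplexMultiplication (IsCMTypeRealisation isSimple_iff_isPrimitive)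
open Literature.AlgebraicGeometry.Pohlmann1968
open Summit.HodgeConjecture.CorCM.CyclotomicFourP (exists_subfield_rho)

/-! ## §1 Nondegeneracy for `p ≡ 5 (mod 8)` -/

section Field

variable {p : ℕ} [Fact p.Prime]
variable {K : Type} [Field K] [NumberField K] [IsCMField K] [IsGalois ℚ K]

omit [Fact p.Prime] in
/-- `p ≡ 5 (mod 8)` forces `p ≠ 2`. [folklore] -/
theorem ne_two_of_mod_eight_eq_five (hp8 : p % 8 = 5) : p ≠ 2 := by rintro rfl; norm_num at hp8

/-- **THEOREM.  `Gal(K/ℚ) ≅ C_p ⋊ C₈` (`φ(1)` = inversion) with `p ≡ 5 (mod 8)`: every PRIMITIVE CM type of `K` is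
NONDEGENERATE** — parts II + III, unconditionally. [cite: Kubota1965, §4 Lemma 2] [cite: Shimura1998, §8.2 Prop. 26]
[cite: FeinGordonSmith1971, pp. 310–315] -/
theorem isNondegenerate_of_isPrimitive_of_mod_eight_eq_five (hp8 : p % 8 = 5)
    (φ : Multiplicative (ZMod 8) →* MulAut (Multiplicative (ZMod p)))
    (hφ : ∀ v : Multiplicative (ZMod p), φ (Multiplicative.ofAdd 1) v = v⁻¹)
    (e : (K ≃ₐ[ℚ] K) ≃* Multiplicative (ZMod p) ⋊[φ] Multiplicative (ZMod 8)) {Φ : CMType K} (φ₀ : K →+* ℂ)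
    (hprim : IsPrimitive (ℂ ≃+* ℂ) Φ.1 φ₀) : IsNondegenerate Φ := by
  obtain ⟨M, ρ, hM, hρ4, hρp, hN⟩ := exists_subfield_rho (Fact.out : p.Prime) hp8
  exact isNondegenerate_of_isPrimitive_cyclicSemidirectEight (ne_two_of_mod_eight_eq_five hp8) φ hφ M ρ hM hρ4 hρp hN
    e φ₀ hprim

/-- The rank: `cmTypeRank Φ = 4p + 1`. [cite: Kubota1965, §2 (p. 115)] -/
theorem cmTypeRank_eq_of_isPrimitive_of_mod_eight_eq_five (hp8 : p % 8 = 5)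
    (φ : Multiplicative (ZMod 8) →* MulAut (Multiplicative (ZMod p)))
    (hφ : ∀ v : Multiplicative (ZMod p), φ (Multiplicative.ofAdd 1) v = v⁻¹)
    (e : (K ≃ₐ[ℚ] K) ≃* Multiplicative (ZMod p) ⋊[φ] Multiplicative (ZMod 8)) {Φ : CMType K} (φ₀ : K →+* ℂ)
    (hprim : IsPrimitive (ℂ ≃+* ℂ) Φ.1 φ₀) : cmTypeRank Φ = 4 * p + 1 := by
  obtain ⟨M, ρ, hM, hρ4, hρp, hN⟩ := exists_subfield_rho (Fact.out : p.Prime) hp8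
  exact cmTypeRank_eq_of_isPrimitive_cyclicSemidirectEight (ne_two_of_mod_eight_eq_five hp8) φ hφ M ρ hM hρ4 hρp hN
    e φ₀ hprim

end Field

/-! ## §2 The Hodge conjecture for the simple CM abelian varieties and their powers -/

section Geometry

variable {p : ℕ} [Fact p.Prime]
variable {K : Type} [Field K] [NumberField K] [IsCMField K] [IsGalois ℚ K]
variable {Φ : CMType K} {A : AbelianVariety ℂ} {ι : 𝓞 K →+* End A}
  {θ : K →+* Module.End ℂ (complexBetti A.X 1)}

/-- **THE HODGE CONJECTURE FOR EVERY POWER OF EVERY SIMPLE ABELIAN VARIETY WITH COMPLEX MULTIPLICATION BY A GALOIS CM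
FIELD WITH GROUP `C_p ⋊ C₈`, `p ≡ 5 (mod 8)`** (`p = 5, 13, 29, 37, 53, 61, …`; dimension `4p`) — unconditionally.
[cite: Gordon1999HodgeAVSurvey, Thm. 6.4] [cite: Shimura1998, §8.2 Prop. 26] -/
theorem hodgeConjectureFor_pow_of_isSimple_of_mod_eight_eq_five (hp8 : p % 8 = 5)
    (φ : Multiplicative (ZMod 8) →* MulAut (Multiplicative (ZMod p)))
    (hφ : ∀ v : Multiplicative (ZMod p), φ (Multiplicative.ofAdd 1) v = v⁻¹)
    (e : (K ≃ₐ[ℚ] K) ≃* Multiplicative (ZMod p) ⋊[φ] Multiplicative (ZMod 8)) (hA : IsCMTypeRealisation Φ A ι θ)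
    (hs : A.IsSimple) (N : ℕ) :
    HodgeConjectureFor (⨁ fun _ : Fin N => A).dim (⨁ fun _ : Fin N => A).X := by
  obtain ⟨M, ρ, hM, hρ4, hρp, hN⟩ := exists_subfield_rho (Fact.out : p.Prime) hp8
  exact hodgeConjectureFor_pow_of_isSimple_cyclicSemidirectEight (ne_two_of_mod_eight_eq_five hp8) φ hφ M ρ hM hρ4 hρp
    hN e hA hs N

/-- The Hodge conjecture for the simple abelian variety itself. [cite: Gordon1999HodgeAVSurvey, Thm. 6.4] -/
theorem hodgeConjectureFor_of_isSimple_of_mod_eight_eq_five (hp8 : p % 8 = 5)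
    (φ : Multiplicative (ZMod 8) →* MulAut (Multiplicative (ZMod p)))
    (hφ : ∀ v : Multiplicative (ZMod p), φ (Multiplicative.ofAdd 1) v = v⁻¹)
    (e : (K ≃ₐ[ℚ] K) ≃* Multiplicative (ZMod p) ⋊[φ] Multiplicative (ZMod 8)) (hA : IsCMTypeRealisation Φ A ι θ)
    (hs : A.IsSimple) : HodgeConjectureFor A.dim A.X := by
  obtain ⟨M, ρ, hM, hρ4, hρp, hN⟩ := exists_subfield_rho (Fact.out : p.Prime) hp8
  exact hodgeConjectureFor_of_isSimple_cyclicSemidirectEight (ne_two_of_mod_eight_eq_five hp8) φ hφ M ρ hM hρ4 hρp hN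
    e hA hs

/-- `Bᵐ(Aⁿ) ⊗ ℂ = Dᵐ(Aⁿ) ⊗ ℂ` on every power (White–Hazama). [cite: Gordon1999HodgeAVSurvey, §9.3] -/
theorem hodgeClassSpan_pow_eq_divisorClassesSpan_of_isSimple_of_mod_eight_eq_five (hp8 : p % 8 = 5)
    (φ : Multiplicative (ZMod 8) →* MulAut (Multiplicative (ZMod p)))
    (hφ : ∀ v : Multiplicative (ZMod p), φ (Multiplicative.ofAdd 1) v = v⁻¹)
    (e : (K ≃ₐ[ℚ] K) ≃* Multiplicative (ZMod p) ⋊[φ] Multiplicative (ZMod 8)) (hA : IsCMTypeRealisation Φ A ι θ)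
    (hs : A.IsSimple) (N m : ℕ) :
    Literature.AlgebraicGeometry.VanGeemen1994.hodgeClassSpan (⨁ fun _ : Fin N => A).dim (⨁ fun _ : Fin N => A).X m =
      Literature.Barriers.HodgeConjecture.divisorClassesSpan (⨁ fun _ : Fin N => A).X
        (⨁ fun _ : Fin N => A).dim m := by
  obtain ⟨M, ρ, hM, hρ4, hρp, hN⟩ := exists_subfield_rho (Fact.out : p.Prime) hp8
  exact hodgeClassSpan_pow_eq_divisorClassesSpan_of_isSimple_cyclicSemidirectEight (ne_two_of_mod_eight_eq_five hp8)
    φ hφ M ρ hM hρ4 hρp hN e hA hs N m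

end Geometry

/-! ## §3 Instances: `p = 5` (order `40`) and `p = 13` (order `104`) -/

section Instances

variable {K : Type} [Field K] [NumberField K] [IsCMField K] [IsGalois ℚ K]
variable {Φ : CMType K} {A : AbelianVariety ℂ} {ι : 𝓞 K →+* End A}
  {θ : K →+* Module.End ℂ (complexBetti A.X 1)}

/-- **`C₅ ⋊ C₈` (order `40`) is GOOD**: the Hodge conjecture for every power of every simple CM abelian `20`-fold with
complex multiplication by a Galois CM field with group `C₅ ⋊ C₈` (generator of `C₈` inverting `C₅`) — the seat's exhaustive
two-sheet census of this group (16 degenerate sheet pairs among `4¹⁰`, all imprimitive) predicted it.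
[cite: Gordon1999HodgeAVSurvey, Thm. 6.4] -/
theorem hodgeConjectureFor_pow_of_isSimple_cyclicFive_semidirect_eight
    (φ : Multiplicative (ZMod 8) →* MulAut (Multiplicative (ZMod 5)))
    (hφ : ∀ v : Multiplicative (ZMod 5), φ (Multiplicative.ofAdd 1) v = v⁻¹)
    (e : (K ≃ₐ[ℚ] K) ≃* Multiplicative (ZMod 5) ⋊[φ] Multiplicative (ZMod 8)) (hA : IsCMTypeRealisation Φ A ι θ)
    (hs : A.IsSimple) (N : ℕ) :
    HodgeConjectureFor (⨁ fun _ : Fin N => A).dim (⨁ fun _ : Fin N => A).X :=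
  haveI : Fact (Nat.Prime 5) := ⟨Nat.prime_five⟩
  hodgeConjectureFor_pow_of_isSimple_of_mod_eight_eq_five (by norm_num) φ hφ e hA hs N

/-- Every primitive CM type of a `(C₅ ⋊ C₈)`-CM field is nondegenerate (rank `21`). [cite: Kubota1965, §4 Lemma 2] -/
theorem isNondegenerate_of_isPrimitive_cyclicFive_semidirect_eight
    (φ : Multiplicative (ZMod 8) →* MulAut (Multiplicative (ZMod 5)))
    (hφ : ∀ v : Multiplicative (ZMod 5), φ (Multiplicative.ofAdd 1) v = v⁻¹)
    (e : (K ≃ₐ[ℚ] K) ≃* Multiplicative (ZMod 5) ⋊[φ] Multiplicative (ZMod 8)) (Φ : CMType K) (φ₀ : K →+* ℂ)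
    (hprim : IsPrimitive (ℂ ≃+* ℂ) Φ.1 φ₀) : IsNondegenerate Φ ∧ cmTypeRank Φ = 21 :=
  haveI : Fact (Nat.Prime 5) := ⟨Nat.prime_five⟩
  ⟨isNondegenerate_of_isPrimitive_of_mod_eight_eq_five (by norm_num) φ hφ e φ₀ hprim,
    cmTypeRank_eq_of_isPrimitive_of_mod_eight_eq_five (by norm_num) φ hφ e φ₀ hprim⟩

/-- **`C₁₃ ⋊ C₈` (order `104`) is GOOD**: the Hodge conjecture for every power of every simple CM abelian `52`-fold with
complex multiplication by a Galois CM field with group `C₁₃ ⋊ C₈`. [cite: Gordon1999HodgeAVSurvey, Thm. 6.4] -/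
theorem hodgeConjectureFor_pow_of_isSimple_cyclicThirteen_semidirect_eight
    (φ : Multiplicative (ZMod 8) →* MulAut (Multiplicative (ZMod 13)))
    (hφ : ∀ v : Multiplicative (ZMod 13), φ (Multiplicative.ofAdd 1) v = v⁻¹)
    (e : (K ≃ₐ[ℚ] K) ≃* Multiplicative (ZMod 13) ⋊[φ] Multiplicative (ZMod 8)) (hA : IsCMTypeRealisation Φ A ι θ)
    (hs : A.IsSimple) (N : ℕ) :
    HodgeConjectureFor (⨁ fun _ : Fin N => A).dim (⨁ fun _ : Fin N => A).X :=
  haveI : Fact (Nat.Prime 13) := ⟨by norm_num⟩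
  hodgeConjectureFor_pow_of_isSimple_of_mod_eight_eq_five (by norm_num) φ hφ e hA hs N

end Instances

end Summit.HodgeConjecture.CorCM.GaloisCyclicSemidirectEight

end
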